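import Summits.ValiantsHypothesis.ValiantsHypothesis.Theorems.EquivariantDialLeviGauge
import Summits.ValiantsHypothesis.ValiantsHypothesis.Theorems.EquivariantDialLayersSuperpoly
import Literature.Computability.AlgebraicComplexity.VonZurGathenSingPermHeight
import HarnessLib

/-!
# The finite-lift cell `A_fin` (KERNEL) and cell `A` modulo `FiniteLiftSupplement`

(decomp-valiant workshop, lens 1, generation 26, file 2 of 2) — support file of the census cell
`A = EquivariantDialNode.EqHardBiPerm` (item `stmt-ValiantsHypothesis-23702`); NOT a route, closes NO item.
HONEST SCOPE: VP ≠ VNP is NOT proved here and nothing below is progress on it; `DcPerSuperpolynomial` untouched;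
cell A itself is NOT proved.  Proved, sorry-free:
* §1 `IsFinEquivariantDetRepr` (the exact lifts lie in ONE FINITE subgroup of `GL_s × GL_s`) and the cell
  `A_fin := EqHardBiPermFin`; the trivial arrow `A ⟹ A_fin` (`eqHardBiPermFin_of_eqHardBiPerm`): `A_fin` is a
  NECESSARY piece of `A`, weaker than `A`, hence than S.
* §2 ★ `A_fin` PROVED (`eqHardBiPermFin`): a polynomial finite-lift family would give — by M2 of file 1
  (`EquivariantDialLeviGauge.exists_hasLeviLiftsAt_of_finLifts`) + von zur Gathen's rank theorem (tree, `m ≥ 3`) + the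
  tree's `per_2` pad + tree arrows `hasBlockGaugeRepr_of_hasLeviLiftsAt`, `hasLayeredWidthLE_of_hasBlockGaugeRepr` — a
  polynomial LAYERED family, contradicting the landed cell `A^lay` (`eqHardLayeredBiPerm`, g25).
* §3 `FiniteLiftSupplement → EqHardBiPerm`: cell `A` REDUCED TO ONE NAMED PAPER STATEMENT («every window-equivariant
  affine determinantal representation of `per_m` admits its lifts inside a finite subgroup» — the finite-supplement
  theorem of Borel–Serre 1964 Lemme 5.11 / Platonov 1966 / Brion 2015 Thm 1.1 applied to the algebraic lift group
  `{(g,h) | ∃ γ, L_γ(A) = g A h⁻¹}`, whose identity component lies in the closed finite-index subgroup `Stab(A)`)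
  [status: PAPER THEOREM (Borel–Serre 1964 L5.11 / Brion 2015 Thm 1.1 on the algebraic lift group); NOT proved in
  the tree — Lean-far; typed ONLY as a hypothesis: no _holds, no instance, no default argument];
  and the g17 stub `CoLeviLifts` follows from it.
GRADE (planner's reading; the critic decides): mechanism KNOWN (LR17 normal form + Maschke + the lineage's layered
bound), kernel-NEW; `A_fin` is an EQUIVARIANT lower bound INSIDE the catalogued equivariance barrier
(Landsberg–Ressayre; Dawar–Wilsenach), 0 S-currency, necessity side only.  MODEL NON-VACUITY (K6): finite-lift
window-equivariant representations of per_m exist on paper for every m (LR17's C(2m,m)−1 construction restricted to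
𝔖_m × 𝔖_m; Grenet's 2^m−1 for one factor) and in kernel for m ≤ 2 (pads): A_fin lower-bounds a non-empty class.
References: [cite: LandsbergRessayre2017, §3.6]; [cite: Vonzurgathen1987, Thm. 3.1];
Borel–Serre, Comment. Math. Helv. 39 (1964) Lemme 5.11; Brion, arXiv:1502.05049, Thm 1.1.
-/

set_option linter.dupNamespace false

namespace Summit.ValiantsHypothesis.ValiantsHypothesis.Theorems.EquivariantDialFiniteLifts

open MvPolynomial Matrix Literature.Computability.AlgebraicComplexity
open EquivariantDialNode EquivariantDialGrading EquivariantDialLayers EquivariantDialLayersSuperpoly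
  EquivariantDialLeviGauge

noncomputable section

/-! ## §1 Finite-lift equivariance and the cell `A_fin` -/
section Defs
variable {σ : Type*} {k : Type*} [Field k] [Fintype σ] [DecidableEq σ]

/-- **FINITE-LIFT EQUIVARIANCE.** `A` is an affine determinantal representation of `f` whose exact lifts
`L_γ(A) = g A h⁻¹` (`γ ∈ Γ`) can all be chosen inside ONE FINITE subgroup of `GL_s(k) × GL_s(k)` (the tree's
`IsEquivariantDetRepr` allows arbitrary lifts; permutation-matrix lifts à la Dawar–Wilsenach are finite-lift). -/
def IsFinEquivariantDetRepr (Γ : Subgroup (GL σ k)) (f : MvPolynomial σ k) {s : ℕ}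
    (A : Matrix (Fin s) (Fin s) (MvPolynomial σ k)) : Prop :=
  IsAffineDetRepr f A ∧ ∃ F : Subgroup (GL (Fin s) k × GL (Fin s) k), Finite F ∧
    ∀ γ ∈ Γ, ∃ p ∈ F, Matrix.linSubstEntries γ A =
      ((p.1 : GL (Fin s) k) : Matrix (Fin s) (Fin s) k).map C * A *
        ((p.2⁻¹ : GL (Fin s) k) : Matrix (Fin s) (Fin s) k).map C

/-- A finite-lift equivariant representation is equivariant (forget finiteness). -/
theorem IsFinEquivariantDetRepr.isEquivariantDetRepr {Γ : Subgroup (GL σ k)} {f : MvPolynomial σ k} {s : ℕ}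
    {A : Matrix (Fin s) (Fin s) (MvPolynomial σ k)} (h : IsFinEquivariantDetRepr Γ f A) :
    IsEquivariantDetRepr Γ f A :=
  ⟨h.1, fun γ hγ => by obtain ⟨-, F, -, hF⟩ := h; obtain ⟨p, -, hp⟩ := hF γ hγ; exact ⟨p.1, p.2, hp⟩⟩

end Defs

/-- **THE CELL `A_fin = EqHardBiPermFin`** (finite-lift equivariant hardness of `per` at the torus-free window
`biPermSubst m ≅ 𝔖_m × 𝔖_m`): NO polynomial family of window-equivariant affine determinantal representations of
`per_m` with finite lift groups.  PROVED below (`eqHardBiPermFin`); a NECESSARY piece of cell `A`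
(`eqHardBiPermFin_of_eqHardBiPerm`), inside the equivariance barrier, 0 S-currency. -/
def EqHardBiPermFin : Prop :=
  ¬ ∃ c : ℕ, ∀ m : ℕ, ∃ s : ℕ, s ≤ m ^ c + c ∧
    ∃ A : Matrix (Fin s) (Fin s) (MvPolynomial (Fin m × Fin m) ℂ),
      IsFinEquivariantDetRepr (biPermSubst m) (perPoly (Fin m) ℂ) A

/-- `A ⟹ A_fin` (KERNEL, the trivial direction): a finite-lift family is an equivariant family. -/
theorem eqHardBiPermFin_of_eqHardBiPerm (h : EqHardBiPerm) : EqHardBiPermFin := fun ⟨c, hc⟩ =>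
  h ⟨c, fun m => (hc m).imp fun _ ⟨hs, A, hA⟩ => ⟨hs, A, hA.isEquivariantDetRepr⟩⟩

/-! ## §2 The cell `A_fin`, PROVED -/
section Window

/-- A `0 × 0` matrix does not represent `per_m` for `m ≥ 1` (its determinant is `1`, while `per_m(0) = 0`). -/
theorem size_pos_of_isAffineDetRepr {m s : ℕ} (hm : 1 ≤ m)
    {A : Matrix (Fin s) (Fin s) (MvPolynomial (Fin m × Fin m) ℂ)} (hA : IsAffineDetRepr (perPoly (Fin m) ℂ) A) :
    0 < s := by
  refine Nat.pos_of_ne_zero fun hs => ?_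
  subst hs
  have h1 := constantCoeff_perPoly ℂ hm
  rw [← hA.2, Matrix.det_isEmpty, map_one] at h1
  exact one_ne_zero h1

/-- FINITE-LIFT BLOCK-GAUGE COST (KERNEL): for `m ≥ 2`, a finite-lift window-equivariant representation of `per_m`
of size `s` yields block-gauge data of inner size `≤ 2 (m + s + 1)`: `s - 1` by M2 + von zur Gathen's rank theorem
(`m ≥ 3`) + tree arrow 1 `hasBlockGaugeRepr_of_hasLeviLiftsAt`; `4` by the tree's `per_2` pad. -/
theorem hasBlockGaugeRepr_of_isFinEquivariantDetRepr {m s : ℕ} (hm : 2 ≤ m)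
    {A : Matrix (Fin s) (Fin s) (MvPolynomial (Fin m × Fin m) ℂ)}
    (hA : IsFinEquivariantDetRepr (biPermSubst m) (perPoly (Fin m) ℂ) A) :
    ∃ N : ℕ, N ≤ 2 * (m + s + 1) ^ 1 ∧ HasBlockGaugeRepr (biPermSubst m) (perPoly (Fin m) ℂ) N := by
  rcases Nat.lt_or_ge m 3 with hlt | hge
  · obtain rfl : m = 2 := by omega
    exact ⟨4, by rw [pow_one]; omega, hasBlockGaugeRepr_perPoly_two⟩
  · obtain ⟨hA0, F, hF, hlift⟩ := hA
    haveI : Finite F := hF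
    obtain ⟨A', i₀, hA', hL⟩ := exists_hasLeviLiftsAt_of_finLifts (size_pos_of_isAffineDetRepr (by omega) hA0)
      (isRegularDetRepr_perPoly vonzurGathen1987_perm_detRepr_rank_holds hge hA0) F.subtype
      (fun γ hγ => by obtain ⟨p, hp, e⟩ := hlift γ hγ; exact ⟨⟨p, hp⟩, e⟩)
    cases s with
    | zero => exact i₀.elim0
    | succ N => exact ⟨N, by rw [pow_one]; omega, hasBlockGaugeRepr_of_hasLeviLiftsAt hA' hL⟩

/-- FINITE-LIFT LAYERING COST (KERNEL): width `≤ 9 (m + s + 1)²` (tree arrow 2; the `m ≤ 1` pads). -/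
theorem hasLayeredWidthLE_of_isFinEquivariantDetRepr {m s : ℕ}
    {A : Matrix (Fin s) (Fin s) (MvPolynomial (Fin m × Fin m) ℂ)}
    (hA : IsFinEquivariantDetRepr (biPermSubst m) (perPoly (Fin m) ℂ) A) :
    ∃ w : ℕ, w ≤ (2 + 1) ^ 2 * (m + s + 1) ^ (2 * 1) ∧ HasLayeredWidthLE (biPermSubst m) (perPoly (Fin m) ℂ) m w := by
  have hone : 1 ≤ (2 + 1) ^ 2 * (m + s + 1) ^ (2 * 1) :=
    Nat.one_le_iff_ne_zero.mpr (Nat.mul_ne_zero (pow_ne_zero _ (by omega)) (pow_ne_zero _ (by omega)))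
  rcases m with _ | _ | d
  · exact ⟨1, hone, LayeredABP.hasLayeredWidthLE_perPoly_zero _⟩
  · exact ⟨1, hone, LayeredABP.hasLayeredWidthLE_perPoly_one _⟩
  · obtain ⟨N, hN, hB⟩ := hasBlockGaugeRepr_of_isFinEquivariantDetRepr (by omega) hA
    refine ⟨N * N + (N + 1), blockGauge_cost_le hN, hasLayeredWidthLE_of_hasBlockGaugeRepr ?_ hB⟩
    simpa only [Fintype.card_fin] using perPoly_isHomogeneous (n := Fin (d + 2)) (k := ℂ)

/-- A polynomial finite-lift family would be a polynomial LAYERED family (polynomial ∘ polynomial). -/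
theorem polyLayered_of_finLift_family (h : ∃ c : ℕ, ∀ m : ℕ, ∃ s : ℕ, s ≤ m ^ c + c ∧
      ∃ A : Matrix (Fin s) (Fin s) (MvPolynomial (Fin m × Fin m) ℂ),
        IsFinEquivariantDetRepr (biPermSubst m) (perPoly (Fin m) ℂ) A) :
    PolyLayered biPermSubst := by
  obtain ⟨c, hc⟩ := h
  obtain ⟨c', hc'⟩ := isPBounded_cost ((2 + 1) ^ 2) (2 * 1) c
  refine ⟨c', fun m => ?_⟩
  obtain ⟨s, hs, A, hA⟩ := hc m
  obtain ⟨w, hw, hW⟩ := hasLayeredWidthLE_of_isFinEquivariantDetRepr hA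
  refine ⟨w, hw.trans ?_, hW⟩
  have hmono : (2 + 1) ^ 2 * (m + s + 1) ^ (2 * 1) ≤ (2 + 1) ^ 2 * (m + (m ^ c + c) + 1) ^ (2 * 1) :=
    Nat.mul_le_mul_left _ (Nat.pow_le_pow_left (by omega) _)
  exact hmono.trans (hc' m)

/-- ★ **THE CELL `A_fin` (KERNEL, unconditional):** no polynomial family of `𝔖_m × 𝔖_m`-window-equivariant
affine determinantal representations of `per_m` with finite lift groups — by the landed layered cell `A^lay`
(`eqHardLayeredBiPerm`).  RIDER: an EQUIVARIANT lower bound (inside the equivariance barrier); proves neither cell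
`A = EqHardBiPerm` (arbitrary lifts: §3) nor `DcPerSuperpolynomial` nor `VP ≠ VNP`.
[cite: LandsbergRessayre2017, §3.6]; [cite: Vonzurgathen1987, Thm. 3.1] -/
theorem eqHardBiPermFin : EqHardBiPermFin := fun h => eqHardLayeredBiPerm (polyLayered_of_finLift_family h)

end Window

/-! ## §3 Cell `A` reduced to the finite supplement of the lift group -/
section Residual

/-- **`FiniteLiftSupplement`** —
[status: PAPER THEOREM (Borel–Serre 1964 L5.11 / Brion 2015 Thm 1.1 on the algebraic lift group); NOT proved in
the tree — Lean-far; typed ONLY as a hypothesis: no _holds, no instance, no default argument].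
Every window-equivariant affine determinantal representation of `per_m` admits its lifts inside a finite subgroup
(on paper: the finite supplement `F · G° = G` of the algebraic lift group `{(g,h) | ∃ γ ∈ Γ, L_γ(A) = g A h⁻¹}`, whose
identity component lies in the closed finite-index subgroup `Stab(A)`; also Platonov 1966).  THE residual of cell `A`
after this file. -/
def FiniteLiftSupplement : Prop :=
  ∀ (m s : ℕ) (A : Matrix (Fin s) (Fin s) (MvPolynomial (Fin m × Fin m) ℂ)),
    IsEquivariantDetRepr (biPermSubst m) (perPoly (Fin m) ℂ) A →
      IsFinEquivariantDetRepr (biPermSubst m) (perPoly (Fin m) ℂ) A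

/-- ★ **CELL `A` MODULO THE FINITE SUPPLEMENT (KERNEL):** `FiniteLiftSupplement → EqHardBiPerm`.  With
`eqHardBiPermFin_of_eqHardBiPerm`: given the paper theorem, `A ⟺ A_fin`, and `A_fin` holds. -/
theorem eqHardBiPerm_of_finiteLiftSupplement (hfin : FiniteLiftSupplement) : EqHardBiPerm := fun ⟨c, hc⟩ =>
  eqHardBiPermFin ⟨c, fun m => (hc m).imp fun s ⟨hs, A, hA⟩ => ⟨hs, A, hfin m s A hA⟩⟩

/-- … and the g17 stub `CoLeviLifts` is DISCHARGED modulo the same statement (M2 + von zur Gathen). -/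
theorem coLeviLifts_of_finiteLiftSupplement (hfin : FiniteLiftSupplement) : CoLeviLifts := by
  intro m s hm A hA hreg
  obtain ⟨-, F, hF, hlift⟩ := hfin m s A hA
  haveI : Finite F := hF
  exact exists_hasLeviLiftsAt_of_finLifts (size_pos_of_isAffineDetRepr (by omega) hA.1) hreg F.subtype
    (fun γ hγ => by obtain ⟨p, hp, e⟩ := hlift γ hγ; exact ⟨⟨p, hp⟩, e⟩)

end Residual

end

end Summit.ValiantsHypothesis.ValiantsHypothesis.Theorems.EquivariantDialFiniteLifts
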